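import Summits.Ventures.PercRepro.S1CoreCapSpecThree

/-!
# PercRepro — TOWARDS THE INSTANCE `ν = 4` OF THE 4-CIRCUIT-CAP SPEC: SHAPES AND SMALL CONFIGURATIONS (p1, gen 23)

The bookkeeping of `S1CoreCapSpecThree` at nullity `4`. With three lines in the configuration every line has weight
`≤ 4` (`wsum_le_four_of_three`); a line of weight `4` forces every other line to have `3` points and no fat point
off it (`shape_of_weight_four`), to be covered by it together with any two further lines
(`subset_of_weight_four`), and hence the configuration to have at most `4` lines (`card_le_four_of_weight_four`:
the two off-line points of a fourth line would each lie on two of the three others). Two lines have caps summing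
to `≤ 8` (`cap_add_cap_le_eight`, the cell `(4,0) + (4,0)`). The remaining case — every line a 3-point line, at
most `8` of them — is `S1CoreCapSpecFourSimple`; the assembly `fourCapSpec_four : FourCapSpec capPaper 4 8` is
`S1CoreCapSpecFourMain`. Axioms: standard.
-/

namespace PercRepro

namespace S1

namespace FourCap

variable {β : Type} [DecidableEq β]

/-- The fat points of `L` split along `U`: those off `U` and those on `U`. -/
theorem fat_sdiff_add_fat_inter (w : β → ℕ) (L U : Finset β) :
    fat w (L \ U) + fat w (L ∩ U) = fat w L := by
  unfold fat
  rw [← Finset.card_union_of_disjoint (Finset.disjoint_filter_filter (Finset.disjoint_sdiff_inter L U)),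
    ← Finset.filter_union, Finset.sdiff_union_inter]

omit [DecidableEq β] in
/-- `fat` is monotone. -/
theorem fat_mono (w : β → ℕ) {S T : Finset β} (h : S ⊆ T) : fat w S ≤ fat w T :=
  Finset.card_le_card (Finset.filter_subset_filter _ h)

/-- The weight of the points of a line off `U` is their number plus the fat ones among them. -/
theorem wsum_sdiff_eq (w : β → ℕ) (L U : Finset β) (hw : ∀ v ∈ L, w v = 1 ∨ w v = 2) :
    wsum w (L \ U) = (L \ U).card + fat w (L \ U) :=
  wsum_eq_card_add_fat w (L \ U) (fun v hv => hw v (Finset.mem_sdiff.1 hv).1)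

/-- Counting helper for the fourth-line argument: a point on the heavy line, or on two of the three other lines. -/
theorem ind_row_four (a b c d : Prop) [Decidable a] [Decidable b] [Decidable c] [Decidable d]
    (h1 : c ∨ b ∨ a) (h2 : d ∨ b ∨ a) (h3 : d ∨ c ∨ a) :
    2 ≤ 2 * (if a then 1 else 0) + (if b then 1 else 0) + (if c then 1 else 0) + (if d then 1 else 0) := by
  by_cases ha : a <;> by_cases hb : b <;> by_cases hc : c <;> by_cases hd : d <;> simp_all

section Four

variable {w : β → ℕ} {ls : Finset (Finset β)}
  (h1 : ∀ L ∈ ls, ∀ v ∈ L, w v = 1 ∨ w v = 2)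
  (h2 : ∀ L ∈ ls, 3 ≤ L.card ∧ wsum w L ≤ 5)
  (h3 : ∀ L ∈ ls, ∀ L' ∈ ls, L ≠ L' → (L ∩ L').card ≤ 1)
  (h4 : ∀ l : List (Finset β), l.Nodup → (∀ L ∈ l, L ∈ ls) → wsum w (unionL l) ≤ 4 + lineRank l)

include h1 h2 h3 h4

/-- **Three lines force weight `≤ 4`** at nullity `4` (the ordering that adds the line first costs `wsum − 2`,
then `≥ 1` for each of the other two). -/
theorem wsum_le_four_of_three {L₁ L₂ L₃ : Finset β} (hL₁ : L₁ ∈ ls) (hL₂ : L₂ ∈ ls) (hL₃ : L₃ ∈ ls)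
    (h21 : L₂ ≠ L₁) (h31 : L₃ ≠ L₁) (h32 : L₃ ≠ L₂) : wsum w L₁ ≤ 4 := by
  have hw : ∀ L ∈ ls, ∀ v ∈ L, 1 ≤ w v := fun L hL v hv => by rcases h1 L hL v hv with h | h <;> omega
  have hc := h4 [L₃, L₂, L₁] (by simp [h21, h31, h32]) (by simp [hL₁, hL₂, hL₃])
  obtain ⟨a1, b1, c1, d1⟩ := cost_step w L₁ [] (hw L₁ hL₁)
  obtain ⟨a2, b2, c2, d2⟩ := cost_step w L₂ [L₁] (hw L₂ hL₂)
  obtain ⟨a3, b3, c3, d3⟩ := cost_step w L₃ [L₂, L₁] (hw L₃ hL₃)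
  obtain ⟨e0, e1, e2, e3⟩ := cost_start w L₁
  have i2 : (L₂ ∩ unionL [L₁]).card ≤ 1 := by
    simp only [unionL, Finset.union_empty]
    exact h3 L₂ hL₂ L₁ hL₁ h21
  have i3 : (L₃ ∩ unionL [L₂, L₁]).card ≤ 2 := by
    simp only [unionL, Finset.union_empty]
    rw [Finset.inter_union_distrib_left]
    refine (Finset.card_union_le _ _).trans ?_
    have := h3 L₃ hL₃ L₂ hL₂ h32
    have := h3 L₃ hL₃ L₁ hL₁ h31
    omega
  have k1 := (h2 L₁ hL₁).1
  have k2 := (h2 L₂ hL₂).1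
  have k3 := (h2 L₃ hL₃).1
  omega

/-- Every line of a configuration with `≥ 3` lines at nullity `4` has weight `≤ 4`. -/
theorem wsum_le_four_of_two_lt_card (hbig : 2 < ls.card) (L : Finset β) (hL : L ∈ ls) : wsum w L ≤ 4 := by
  obtain ⟨a, b, c, ha, hb, hc, hab, hac, hbc⟩ := Finset.two_lt_card_iff.1 hbig
  by_cases e1 : L = a
  · subst e1
    exact wsum_le_four_of_three h1 h2 h3 h4 hL hb hc hab.symm hac.symm hbc.symm
  by_cases e2 : L = b
  · subst e2
    exact wsum_le_four_of_three h1 h2 h3 h4 hL ha hc hab hbc.symm hac.symm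
  · exact wsum_le_four_of_three h1 h2 h3 h4 hL ha hb (Ne.symm e1) (Ne.symm e2) hab.symm

/-- **A line of weight `4` shapes the others**: with a third line present, any other line has `3` points and no fat
point off the heavy line (the ordering heavy line first costs `2`, the other line `|L₂| − 2 + fat (L₂ ∖ L₁)`, the
third `≥ 1`). -/
theorem shape_of_weight_four {L₁ L₂ L₃ : Finset β} (hL₁ : L₁ ∈ ls) (hL₂ : L₂ ∈ ls) (hL₃ : L₃ ∈ ls)
    (h21 : L₂ ≠ L₁) (h31 : L₃ ≠ L₁) (h32 : L₃ ≠ L₂) (hw4 : wsum w L₁ = 4) :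
    L₂.card = 3 ∧ fat w (L₂ \ L₁) = 0 := by
  have hw : ∀ L ∈ ls, ∀ v ∈ L, 1 ≤ w v := fun L hL v hv => by rcases h1 L hL v hv with h | h <;> omega
  have hc := h4 [L₃, L₂, L₁] (by simp [h21, h31, h32]) (by simp [hL₁, hL₂, hL₃])
  obtain ⟨a1, b1, c1, d1⟩ := cost_step w L₁ [] (hw L₁ hL₁)
  obtain ⟨a2, b2, c2, d2⟩ := cost_step w L₂ [L₁] (hw L₂ hL₂)
  obtain ⟨a3, b3, c3, d3⟩ := cost_step w L₃ [L₂, L₁] (hw L₃ hL₃)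
  obtain ⟨e0, e1, e2, e3⟩ := cost_start w L₁
  have i2 : (L₂ ∩ unionL [L₁]).card ≤ 1 := by
    simp only [unionL, Finset.union_empty]
    exact h3 L₂ hL₂ L₁ hL₁ h21
  have i3 : (L₃ ∩ unionL [L₂, L₁]).card ≤ 2 := by
    simp only [unionL, Finset.union_empty]
    rw [Finset.inter_union_distrib_left]
    refine (Finset.card_union_le _ _).trans ?_
    have := h3 L₃ hL₃ L₂ hL₂ h32
    have := h3 L₃ hL₃ L₁ hL₁ h31
    omega
  have f2 := wsum_sdiff_eq w L₂ (unionL [L₁]) (h1 L₂ hL₂)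
  have hf : fat w (L₂ \ unionL [L₁]) = fat w (L₂ \ L₁) := by simp [unionL]
  have k1 := (h2 L₁ hL₁).1
  have k2 := (h2 L₂ hL₂).1
  have k3 := (h2 L₃ hL₃).1
  omega

/-- **A line of weight `4` covers with any two others**: a fourth line lies in the union of the heavy line and any
two further lines (`2 + 1 + 1` is already spent). -/
theorem subset_of_weight_four {L₁ A B C : Finset β} (hL₁ : L₁ ∈ ls) (hA : A ∈ ls) (hB : B ∈ ls) (hC : C ∈ ls)
    (hA1 : A ≠ L₁) (hB1 : B ≠ L₁) (hBA : B ≠ A) (hC1 : C ≠ L₁) (hCA : C ≠ A) (hCB : C ≠ B)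
    (hw4 : wsum w L₁ = 4) : ∀ v ∈ C, v ∈ B ∨ v ∈ A ∨ v ∈ L₁ := by
  have hw : ∀ L ∈ ls, ∀ v ∈ L, 1 ≤ w v := fun L hL v hv => by rcases h1 L hL v hv with h | h <;> omega
  have hc := h4 [C, B, A, L₁] (by simp [hA1, hB1, hBA, hC1, hCA, hCB]) (by simp [hL₁, hA, hB, hC])
  obtain ⟨a1, b1, c1, d1⟩ := cost_step w L₁ [] (hw L₁ hL₁)
  obtain ⟨a2, b2, c2, d2⟩ := cost_step w A [L₁] (hw A hA)
  obtain ⟨a3, b3, c3, d3⟩ := cost_step w B [A, L₁] (hw B hB)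
  obtain ⟨a4, b4, c4, d4⟩ := cost_step w C [B, A, L₁] (hw C hC)
  obtain ⟨e0, e1, e2, e3⟩ := cost_start w L₁
  have i2 : (A ∩ unionL [L₁]).card ≤ 1 := by
    simp only [unionL, Finset.union_empty]
    exact h3 A hA L₁ hL₁ hA1
  have i3 : (B ∩ unionL [A, L₁]).card ≤ 2 := by
    simp only [unionL, Finset.union_empty]
    rw [Finset.inter_union_distrib_left]
    refine (Finset.card_union_le _ _).trans ?_
    have := h3 B hB A hA hBA
    have := h3 B hB L₁ hL₁ hB1
    omega
  have k1 := (h2 L₁ hL₁).1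
  have kA := (h2 A hA).1
  have kB := (h2 B hB).1
  have kC := (h2 C hC).1
  have hzero : (C \ unionL [B, A, L₁]).card = 0 := by omega
  have hsub : C ⊆ unionL [B, A, L₁] := Finset.sdiff_eq_empty_iff_subset.1 (Finset.card_eq_zero.1 hzero)
  intro v hv
  have h := hsub hv
  rw [mem_unionL_iff] at h
  simpa using h

/-- **A line of weight `4` leaves room for at most three others**: with four further lines, the two points of one of
them off the heavy line would each lie on two of the three remaining lines, while each of those meets it in at most
one point (`4 ≤ 3`). -/
theorem card_le_four_of_weight_four {L₁ : Finset β} (hL₁ : L₁ ∈ ls) (hw4 : wsum w L₁ = 4) : ls.card ≤ 4 := by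
  by_contra hlt
  push Not at hlt
  -- four further lines
  have hcard : 2 < (ls.erase L₁).card := by
    rw [Finset.card_erase_of_mem hL₁]; omega
  obtain ⟨a, b, c, ha, hb, hc, hab, hac, hbc⟩ := Finset.two_lt_card_iff.1 hcard
  have hb' : b ∈ (ls.erase L₁).erase a := Finset.mem_erase.2 ⟨hab.symm, hb⟩
  have hc' : c ∈ ((ls.erase L₁).erase a).erase b :=
    Finset.mem_erase.2 ⟨hbc.symm, Finset.mem_erase.2 ⟨hac.symm, hc⟩⟩
  have hcard' : 0 < ((((ls.erase L₁).erase a).erase b).erase c).card := by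
    rw [Finset.card_erase_of_mem hc', Finset.card_erase_of_mem hb', Finset.card_erase_of_mem ha,
      Finset.card_erase_of_mem hL₁]
    omega
  obtain ⟨d, hd⟩ := Finset.card_pos.1 hcard'
  simp only [Finset.mem_erase] at ha hb hc hd
  -- `a` has three points
  have ha3 : a.card = 3 := (shape_of_weight_four h1 h2 h3 h4 hL₁ ha.2 hb.2 ha.1 hb.1 hab.symm hw4).1
  obtain ⟨x, y, z, hxy, hxz, hyz, haeq⟩ := Finset.card_eq_three.1 ha3
  have hx : x ∈ a := by rw [haeq]; simp
  have hy : y ∈ a := by rw [haeq]; simp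
  have hz : z ∈ a := by rw [haeq]; simp
  -- the coverings of `a` by the heavy line and two of `b, c, d`
  have cbc := subset_of_weight_four h1 h2 h3 h4 hL₁ hb.2 hc.2 ha.2 hb.1 hc.1 hbc.symm ha.1 hab hac hw4
  have cbd := subset_of_weight_four h1 h2 h3 h4 hL₁ hb.2 hd.2.2.2.2 ha.2 hb.1 hd.2.2.2.1 hd.2.1 ha.1 hab
    (Ne.symm hd.2.2.1) hw4
  have ccd := subset_of_weight_four h1 h2 h3 h4 hL₁ hc.2 hd.2.2.2.2 ha.2 hc.1 hd.2.2.2.1 hd.1 ha.1 hac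
    (Ne.symm hd.2.2.1) hw4
  -- every line other than `a` contains at most one of `x, y, z`
  have col : ∀ L ∈ ls, L ≠ a → ∀ u ∈ a, ∀ u' ∈ a, u ≠ u' → u ∈ L → u' ∈ L → False := by
    intro L hL hne u hu u' hu' huu' huL hu'L
    exact huu' (Finset.card_le_one.1 (h3 L hL a ha.2 hne) u (Finset.mem_inter.2 ⟨huL, hu⟩) u'
      (Finset.mem_inter.2 ⟨hu'L, hu'⟩))
  have rx := ind_row_four (x ∈ L₁) (x ∈ b) (x ∈ c) (x ∈ d) (cbc x hx) (cbd x hx) (ccd x hx)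
  have ry := ind_row_four (y ∈ L₁) (y ∈ b) (y ∈ c) (y ∈ d) (cbc y hy) (cbd y hy) (ccd y hy)
  have rz := ind_row_four (z ∈ L₁) (z ∈ b) (z ∈ c) (z ∈ d) (cbc z hz) (cbd z hz) (ccd z hz)
  have k1 := ind_le_one (x ∈ L₁) (y ∈ L₁) (z ∈ L₁) (col L₁ hL₁ (Ne.symm ha.1) x hx y hy hxy)
    (col L₁ hL₁ (Ne.symm ha.1) x hx z hz hxz) (col L₁ hL₁ (Ne.symm ha.1) y hy z hz hyz)
  have kb := ind_le_one (x ∈ b) (y ∈ b) (z ∈ b) (col b hb.2 hab.symm x hx y hy hxy)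
    (col b hb.2 hab.symm x hx z hz hxz) (col b hb.2 hab.symm y hy z hz hyz)
  have kc := ind_le_one (x ∈ c) (y ∈ c) (z ∈ c) (col c hc.2 hac.symm x hx y hy hxy)
    (col c hc.2 hac.symm x hx z hz hxz) (col c hc.2 hac.symm y hy z hz hyz)
  have kd := ind_le_one (x ∈ d) (y ∈ d) (z ∈ d) (col d hd.2.2.2.2 hd.2.2.1 x hx y hy hxy)
    (col d hd.2.2.2.2 hd.2.2.1 x hx z hz hxz) (col d hd.2.2.2.2 hd.2.2.1 y hy z hz hyz)
  omega

/-- **Two lines** at nullity `4` have caps summing to `≤ 8` (the cell `(4,0) + (4,0)`). -/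
theorem cap_add_cap_le_eight {L L' : Finset β} (hL : L ∈ ls) (hL' : L' ∈ ls) (hne : L' ≠ L) :
    capPaper L.card (fat w L) + capPaper L'.card (fat w L') ≤ 8 := by
  have hc := two_line_cost h4 hL hL' hne
  have hint : (L' ∩ L).card ≤ 1 := h3 L' hL' L hL hne
  have kL := h2 L hL
  have kL' := h2 L' hL'
  have wL := wsum_eq_card_add_fat w L (h1 L hL)
  have wL' := wsum_eq_card_add_fat w L' (h1 L' hL')
  have hsd : (L' \ L).card + (L' ∩ L).card = L'.card := by
    rw [Finset.card_sdiff, Finset.inter_comm]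
    exact Nat.sub_add_cancel (Finset.card_le_card Finset.inter_subset_left)
  have hwu : wsum w (L' ∪ L) = wsum w L' + wsum w (L \ L') := (wsum_union_ge w L' L).symm
  have hsplit : wsum w (L \ L') + wsum w (L ∩ L') = wsum w L := by
    rw [← wsum_union_of_disjoint w (Finset.disjoint_sdiff_inter L L'), Finset.sdiff_union_inter]
  have hcases : (L.card = 3 ∧ fat w L = 0) ∨ (L.card = 4 ∧ fat w L = 0) ∨ (L.card = 5 ∧ fat w L = 0) ∨
      (L.card = 3 ∧ fat w L = 1) ∨ (L.card = 4 ∧ fat w L = 1) ∨ (L.card = 3 ∧ fat w L = 2) := by omega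
  have hcases' : (L'.card = 3 ∧ fat w L' = 0) ∨ (L'.card = 4 ∧ fat w L' = 0) ∨ (L'.card = 5 ∧ fat w L' = 0) ∨
      (L'.card = 3 ∧ fat w L' = 1) ∨ (L'.card = 4 ∧ fat w L' = 1) ∨ (L'.card = 3 ∧ fat w L' = 2) := by omega
  have hcomm : (L ∩ L').card = (L' ∩ L).card := by rw [Finset.inter_comm]
  rcases (by omega : (L ∩ L').card = 0 ∨ (L ∩ L').card = 1) with h0 | hone
  · have hempty : wsum w (L ∩ L') = 0 := by
      rw [Finset.card_eq_zero.1 h0]; simp [wsum]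
    rcases hcases with ⟨hk, hf⟩ | ⟨hk, hf⟩ | ⟨hk, hf⟩ | ⟨hk, hf⟩ | ⟨hk, hf⟩ | ⟨hk, hf⟩ <;>
      rcases hcases' with ⟨hk', hf'⟩ | ⟨hk', hf'⟩ | ⟨hk', hf'⟩ | ⟨hk', hf'⟩ | ⟨hk', hf'⟩ | ⟨hk', hf'⟩ <;>
      first | omega | (rw [hk, hf, hk', hf']; decide)
  · obtain ⟨p, hp⟩ := Finset.card_eq_one.1 hone
    have hpL : p ∈ L := (Finset.mem_inter.1 (hp ▸ Finset.mem_singleton_self p)).1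
    have hpL' : p ∈ L' := (Finset.mem_inter.1 (hp ▸ Finset.mem_singleton_self p)).2
    have hwp : wsum w (L ∩ L') = w p := by rw [hp]; simp [wsum]
    rcases h1 L hL p hpL with hp1 | hp2
    · rcases hcases with ⟨hk, hf⟩ | ⟨hk, hf⟩ | ⟨hk, hf⟩ | ⟨hk, hf⟩ | ⟨hk, hf⟩ | ⟨hk, hf⟩ <;>
        rcases hcases' with ⟨hk', hf'⟩ | ⟨hk', hf'⟩ | ⟨hk', hf'⟩ | ⟨hk', hf'⟩ | ⟨hk', hf'⟩ | ⟨hk', hf'⟩ <;>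
        first | omega | (rw [hk, hf, hk', hf']; decide)
    · have hfL : 1 ≤ fat w L := by
        unfold fat
        exact Finset.card_pos.2 ⟨p, Finset.mem_filter.2 ⟨hpL, hp2⟩⟩
      have hfL' : 1 ≤ fat w L' := by
        unfold fat
        exact Finset.card_pos.2 ⟨p, Finset.mem_filter.2 ⟨hpL', hp2⟩⟩
      rcases hcases with ⟨hk, hf⟩ | ⟨hk, hf⟩ | ⟨hk, hf⟩ | ⟨hk, hf⟩ | ⟨hk, hf⟩ | ⟨hk, hf⟩ <;>
        rcases hcases' with ⟨hk', hf'⟩ | ⟨hk', hf'⟩ | ⟨hk', hf'⟩ | ⟨hk', hf'⟩ | ⟨hk', hf'⟩ | ⟨hk', hf'⟩ <;>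
        first | omega | (rw [hk, hf, hk', hf']; decide)

end Four

end FourCap

end S1

end PercRepro
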